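import Literature.Computability.Complexity.CircuitClassesProofs
import Literature.Computability.Complexity.TimeBoundsComplProofs
import HarnessLib

/-!
# `co P/poly = P/poly` (proof; trunk CplxCore)

Discharge (D-0014) of the named fact `Literature.Computability.Complexity.co_PPoly` (`CircuitClasses.lean`; Arora–Barak
2009, §6.1): a polynomial-size circuit family for `L` becomes one for `Lᶜ` by one more `NOT` gate on
the output — in the gate-list calculus of `CircuitComposition.lean`: `Circuit.cktSize_eval`, then
`CktSize.comp` with `cktSize_not`, then `CktSize.toCircuit`; the size polynomial is `q + 1`.

## References

* S. Arora, B. Barak, *Computational Complexity: A Modern Approach*, CUP 2009, §6.1, Def. 6.5.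
-/

namespace Literature.Computability.Complexity

open Polynomial

/-- **`P/poly` is closed under complement**: `L ∈ P/poly ⇒ Lᶜ ∈ P/poly` (negate the output gate;
size `q(n) + 1`). [Arora–Barak 2009, §6.1] [cite: AroraBarakCC2009, §6.1] -/
theorem compl_mem_PPoly {L : Language Bool} (hL : L ∈ PPoly) : Lᶜ ∈ PPoly := by
  obtain ⟨q, C, hC, hdec⟩ : ∃ q : Polynomial ℕ, ∃ C : CircuitFamily,
      (∀ n, (C n).IsOver B2 ∧ (C n).size ≤ q.eval n) ∧ C.Decides L := by
    simpa [PPoly, SIZE] using hL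
  have main : ∀ n : ℕ, ∃ D : Circuit (Fin n), D.IsOver B2 ∧ D.size ≤ (q + 1).eval n ∧
      ∀ u : Fin n → Bool, D.eval u = Lᶜ.boolIndicator (List.ofFn u) := by
    intro n
    have h1 := ((C n).cktSize_eval (hC n).1).of_le (hC n).2
    have h2 : CktSize B2 (fun (x : Fin n → Bool) (_ : Unit) => !((C n).eval x)) (q.eval n + 1) :=
      (h1.comp (cktSize_not ())).congr fun x _ => rfl
    obtain ⟨D, hDB, hDs, hDe⟩ := h2.toCircuit
    refine ⟨D, hDB, by simpa using hDs, fun u => ?_⟩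
    rw [hDe u, hdec.eval_eq u]
    exact (boolIndicator_compl_apply (L : Set (List Bool)) (List.ofFn u)).symm
  choose D hD using main
  refine Set.mem_iUnion.2 ⟨q + 1, D, fun n => ⟨(hD n).1, (hD n).2.1⟩, fun x => ?_⟩
  have := (hD x.length).2.2 x.get
  rwa [List.ofFn_get] at this

/-- **Discharge of `co_PPoly`**: `co P/poly = P/poly`. [Arora–Barak 2009, §6.1] [cite: AroraBarakCC2009, §6.1] -/
theorem co_PPoly_holds : co_PPoly := by
  ext L
  refine ⟨fun h => ?_, fun h => compl_mem_PPoly h⟩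
  have h' : Lᶜᶜ ∈ PPoly := compl_mem_PPoly h
  rwa [compl_compl] at h'

end Literature.Computability.Complexity
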